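import Mathlib
import Literature.NumberTheory.LFunctions.UniformWeilPositivityRH
import Literature.NumberTheory.LFunctions.YoshidaPositivityThreshold
import Literature.NumberTheory.LFunctions.RiemannHypothesisUpTo101
import Literature.NumberTheory.LFunctions.KeiperLiPositivityUpTo
import Literature.NumberTheory.DiophantineGeometry.NamedHypotheses
import Literature.NumberTheory.DiophantineGeometry.NamedHypothesesRHProofs
import Summits.RiemannHypothesis.RiemannHypothesis.Theorems.MotivicDoorRungs
import Summits.RiemannHypothesis.RiemannHypothesis.Theorems.HandoffLadderRungOne
import Summits.RiemannHypothesis.Statement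
import HarnessLib

/-!
# RiemannHypothesis / Splittings — Weil HEIGHT-TRANSFER detectors: the quantifier table and the blindness law of
`W-HT(a,T) := RiemannHypothesisUpTo T → WeilPositivityOn a` (RAW zero-def form of cell rh-split, seat (weil, finite) gen 2)

Raw form (typer-2 g2) of §§0–2 of `HOME/rh-split-weil-finite/SketchG2.lean` (sha16 f42f5c37788dc98c; referee g2 replay
00:32Z std, content pre-file PASS for these zero-analysis detectors; typer-2 H1 std on `wht_const101_iff_rh`): the Props
`HeightTransfer a T` and `WHT T₁ := ∀ a, HeightTransfer a (T₁ a)` are WRITTEN OUT (theorems only).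
* QUANTIFIER TABLE (cell target T13 = W-HT): every `∃`-form is a VACUOUS theorem (`exists_height_forall_window`,
  `forall_window_exists_height`, `exists_schedule`, `exists_scale_vacuous` — an unnamed constant is no content); for a
  fixed window «every height transfers» IS `FIN(a)` (`forall_height_iff_fin`, kernel height 101); for a fixed certified
  height «every window transfers» IS RH (`forall_window_iff_rh`, `wht_const101_iff_rh`).
* BLINDNESS LAW: a schedule transfers iff every window where Weil positivity fails is scheduled at an uncertifiable height
  (`wht_iff_detect`), iff `RH ∨` every window beyond Yoshida's threshold is so scheduled (`wht_iff_rh_or_threshold`); an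
  explicit schedule pays `RH ∨ a ≤ a₀` at a certified height (`rh_or_le_threshold_of_wht`); schedules are upward closed
  and only matter on `a > 1`.
Referee/lead booking (H6, 00:32Z): T13 re-booked as «WHTArch explicit law — OPEN, RH-implied; ∃-forms vacuous THEOREMS;
constant forms ≡ RH»; seat class UNCHANGED, 0 survivors.
SPLITTING SEARCH over kernel-typed RH-EQUIVALENCES; a splitting A ∧ B ⟹ RH is CONDITIONAL bookkeeping unless A and B are
both proved; nothing here bears on the truth of RH.
-/

open Set MeasureTheory
open Literature.NumberTheory.LFunctions Literature.NumberTheory.DiophantineGeometry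
open Summit.RiemannHypothesis.RiemannHypothesis.Theorems
open Summit.RiemannHypothesis.RiemannHypothesis.Theorems.MotivicDoor.Rungs
open Summit.RiemannHypothesis.RiemannHypothesis.Theorems.WeilFormatCData.A1 (weilPositivityOn_one)

set_option linter.dupNamespace false

noncomputable section

namespace Summit.RiemannHypothesis.RiemannHypothesis.Theorems.Splittings.WeilHeightTransferDetectors

/-- RH gives Weil positivity on EVERY window (for `a ≤ 1` unconditionally, by the `a = 1` rung). -/
theorem weilPositivityOn_of_rh (h : Summit.RiemannHypothesis) (a : ℝ) : WeilPositivityOn a := by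
  rcases le_or_gt a 1 with ha | ha
  · exact weilPositivityOn_one.mono ha
  · exact rung_of_riemannHypothesis h (one_pos.trans ha)

/-- `FIN(a)` transfers at every height. -/
theorem heightTransfer_of_weilPositivityOn {a : ℝ} (h : WeilPositivityOn a) (T : ℝ) : (RiemannHypothesisUpTo T → WeilPositivityOn a) :=
  fun _ ↦ h

/-- Inside the proved reach the transfer is content-free. -/
theorem heightTransfer_of_le_one {a : ℝ} (ha : a ≤ 1) (T : ℝ) : (RiemannHypothesisUpTo T → WeilPositivityOn a) :=
  heightTransfer_of_weilPositivityOn (weilPositivityOn_one.mono ha) T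

/-- Under RH every window transfers at every height. -/
theorem heightTransfer_of_rh (h : Summit.RiemannHypothesis) (a T : ℝ) : (RiemannHypothesisUpTo T → WeilPositivityOn a) :=
  heightTransfer_of_weilPositivityOn (weilPositivityOn_of_rh h a) T

/-- A height at which RH is NOT certified transfers vacuously. -/
theorem heightTransfer_of_not_upTo {T : ℝ} (h : ¬ RiemannHypothesisUpTo T) (a : ℝ) : (RiemannHypothesisUpTo T → WeilPositivityOn a) :=
  fun hT ↦ (h hT).elim

/-- Transfer is monotone: smaller window, larger height. -/
theorem heightTransfer_mono {a a' T T' : ℝ} (h : (RiemannHypothesisUpTo T → WeilPositivityOn a)) (ha : a' ≤ a) (hT : T ≤ T') :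
    (RiemannHypothesisUpTo T' → WeilPositivityOn a') := fun hup ↦ (h (riemannHypothesisUpTo_anti hT hup)).mono ha

/-- Under `¬RH` some height is not certifiable (tree: `RH ↔ ∀ T, RiemannHypothesisUpTo T`, discharged in
`NamedHypothesesRHProofs`). -/
theorem exists_not_upTo_of_not_rh (h : ¬ Summit.RiemannHypothesis) : ∃ T : ℝ, ¬ RiemannHypothesisUpTo T := by
  by_contra hcon
  push Not at hcon
  exact h (Summit.RiemannHypothesis_iff.2 (riemannHypothesis_of_forall_riemannHypothesisUpTo_holds hcon))

/-! ## §1 Quantifier table (VACUITY of every `∃`-form; `∀`-forms are RH or FIN) -/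

/-- VACUOUS 1: «one height serves every window» is an RH-free THEOREM (cases on RH). -/
theorem exists_height_forall_window : ∃ T : ℝ, ∀ a : ℝ, (RiemannHypothesisUpTo T → WeilPositivityOn a) := by
  by_cases h : Summit.RiemannHypothesis
  · exact ⟨0, fun a ↦ heightTransfer_of_rh h a 0⟩
  · obtain ⟨T, hT⟩ := exists_not_upTo_of_not_rh h
    exact ⟨T, fun a ↦ heightTransfer_of_not_upTo hT a⟩

/-- VACUOUS 2 (= g0 card §4 «CONJECTURE W-HT: ∀ a > 0 ∃ T*(a)» as literally quantified): THEOREM. -/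
theorem forall_window_exists_height : ∀ a : ℝ, ∃ T : ℝ, (RiemannHypothesisUpTo T → WeilPositivityOn a) := fun a ↦
  exists_height_forall_window.imp fun _ h ↦ h a

/-- VACUOUS 3: some schedule transfers. -/
theorem exists_schedule : ∃ T₁ : ℝ → ℝ, (∀ a : ℝ, RiemannHypothesisUpTo (T₁ a) → WeilPositivityOn a) := by
  obtain ⟨T, h⟩ := exists_height_forall_window
  exact ⟨fun _ ↦ T, h⟩

/-- VACUOUS 4: «∃ C, the schedule `C · f` transfers» for ANY shape `f ≥ 1` — an unnamed constant is no content. -/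
theorem exists_scale_vacuous (f : ℝ → ℝ) (hf : ∀ a, 1 ≤ f a) : ∃ C : ℝ, (∀ a : ℝ, RiemannHypothesisUpTo (C * f a) → WeilPositivityOn a) := by
  by_cases h : Summit.RiemannHypothesis
  · exact ⟨0, fun a ↦ heightTransfer_of_rh h a _⟩
  · obtain ⟨T, hT⟩ := exists_not_upTo_of_not_rh h
    refine ⟨max T 0, fun a hup ↦ (hT (riemannHypothesisUpTo_anti ?_ hup)).elim⟩
    calc T ≤ max T 0 := le_max_left _ _
      _ = max T 0 * 1 := (mul_one _).symm
      _ ≤ max T 0 * f a := mul_le_mul_of_nonneg_left (hf a) (le_max_right _ _)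

/-- Fixed window: «every height transfers» IS `FIN(a)` (kernel height `101` certifies one height). -/
theorem forall_height_iff_fin (a : ℝ) : (∀ T : ℝ, (RiemannHypothesisUpTo T → WeilPositivityOn a)) ↔ WeilPositivityOn a :=
  ⟨fun h ↦ h 101 riemannHypothesisUpTo_hundredOne, fun h T ↦ heightTransfer_of_weilPositivityOn h T⟩

/-- Fixed CERTIFIED height: «every window transfers» IS RH. -/
theorem forall_window_iff_rh {T : ℝ} (hT : RiemannHypothesisUpTo T) :
    (∀ a : ℝ, (RiemannHypothesisUpTo T → WeilPositivityOn a)) ↔ Summit.RiemannHypothesis := by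
  refine ⟨fun h ↦ ?_, fun h a ↦ heightTransfer_of_rh h a T⟩
  rw [Summit.RiemannHypothesis_iff, riemannHypothesis_iff_forall_weilPositivityOn]
  exact fun a _ ↦ h a hT

/-- «Every height transfers to every window» IS RH (kernel height 101). -/
theorem forall_forall_iff_rh : (∀ T a : ℝ, (RiemannHypothesisUpTo T → WeilPositivityOn a)) ↔ Summit.RiemannHypothesis :=
  ⟨fun h ↦ (forall_window_iff_rh riemannHypothesisUpTo_hundredOne).1 (h 101),
    fun h T a ↦ heightTransfer_of_rh h a T⟩

/-- A CONSTANT schedule carries no transfer: at a certified height it is RH (kernel height `101`; with F1 the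
same at `3 000 175 332 800`). -/
theorem wht_const_iff_rh {T : ℝ} (hT : RiemannHypothesisUpTo T) : (∀ a : ℝ, RiemannHypothesisUpTo T → WeilPositivityOn a) ↔ Summit.RiemannHypothesis :=
  forall_window_iff_rh hT

/-- The constant schedule at the kernel-certified height 101 IS RH. -/
theorem wht_const101_iff_rh : (∀ a : ℝ, RiemannHypothesisUpTo 101 → WeilPositivityOn a) ↔ Summit.RiemannHypothesis :=
  wht_const_iff_rh riemannHypothesisUpTo_hundredOne

/-! ## §2 The blindness law: an explicit schedule = an RH-free lower bound for Yoshida's threshold -/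

/-- DETECTION form: a schedule transfers iff every window where Weil positivity FAILS already sees a failure
of RH below its scheduled height. -/
theorem wht_iff_detect (T₁ : ℝ → ℝ) :
    (∀ a : ℝ, RiemannHypothesisUpTo (T₁ a) → WeilPositivityOn a) ↔ ∀ a : ℝ, ¬ WeilPositivityOn a → ¬ RiemannHypothesisUpTo (T₁ a) :=
  forall_congr' fun _ ↦ ⟨fun h hW hT ↦ hW (h hT), fun h hT ↦ not_not.1 fun hW ↦ h hW hT⟩

/-- A window where positivity fails is `> 1` (the proved reach), in particular positive. -/
theorem one_lt_of_not_weilPositivityOn {a : ℝ} (h : ¬ WeilPositivityOn a) : 1 < a :=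
  lt_of_not_ge fun hle ↦ h (weilPositivityOn_one.mono hle)

/-- THRESHOLD form (Yoshida's dichotomy `WeilPositivityOn a ↔ RH ∨ a ≤ a₀`): a schedule transfers iff RH, or
every window beyond the threshold `a₀` is scheduled at an UNcertifiable height. -/
theorem wht_iff_rh_or_threshold (T₁ : ℝ → ℝ) :
    (∀ a : ℝ, RiemannHypothesisUpTo (T₁ a) → WeilPositivityOn a) ↔ Summit.RiemannHypothesis ∨
      ∀ a : ℝ, 0 < a → weilPositivityThreshold < a → ¬ RiemannHypothesisUpTo (T₁ a) := by
  constructor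
  · intro h
    by_cases hRH : Summit.RiemannHypothesis
    · exact Or.inl hRH
    · exact Or.inr fun a ha hlt hT ↦ (not_weilPositivityOn_iff_threshold_lt hRH ha).2 hlt (h a hT)
  · rintro (hRH | hdet) a hT
    · exact weilPositivityOn_of_rh hRH a
    · by_contra hW
      have ha : 0 < a := one_pos.trans (one_lt_of_not_weilPositivityOn hW)
      by_cases hRH : Summit.RiemannHypothesis
      · exact hW (weilPositivityOn_of_rh hRH a)
      · exact hdet a ha ((not_weilPositivityOn_iff_threshold_lt hRH ha).1 hW) hT

/-- What an explicit schedule PAYS once a height is certified: `RH ∨ a ≤ a₀` — an RH-free lower bound on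
Yoshida's threshold (today's kernel instance: `a₀ ≥ 1` under `¬RH`, from the `a = 1` rung). -/
theorem rh_or_le_threshold_of_wht {T₁ : ℝ → ℝ} (h : (∀ a : ℝ, RiemannHypothesisUpTo (T₁ a) → WeilPositivityOn a)) {a : ℝ} (ha : 0 < a)
    (hT : RiemannHypothesisUpTo (T₁ a)) : Summit.RiemannHypothesis ∨ a ≤ weilPositivityThreshold :=
  rh_or_le_threshold_of_rung ha (h a hT)

/-- Schedules are upward closed (a later height is a stronger hypothesis). -/
theorem wht_mono {T₁ T₂ : ℝ → ℝ} (h : (∀ a : ℝ, RiemannHypothesisUpTo (T₁ a) → WeilPositivityOn a)) (h12 : ∀ a, T₁ a ≤ T₂ a) : (∀ a : ℝ, RiemannHypothesisUpTo (T₂ a) → WeilPositivityOn a) :=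
  fun a hup ↦ h a (riemannHypothesisUpTo_anti (h12 a) hup)

/-- … and only their values on windows `a > 1` matter. -/
theorem wht_of_forall_one_lt {T₁ : ℝ → ℝ} (h : ∀ a : ℝ, 1 < a → (RiemannHypothesisUpTo (T₁ a) → WeilPositivityOn a)) : (∀ a : ℝ, RiemannHypothesisUpTo (T₁ a) → WeilPositivityOn a) := fun a ↦ by
  rcases le_or_gt a 1 with ha | ha
  · exact heightTransfer_of_le_one ha _
  · exact h a ha

/-- Bookkeeping for the reach table: an explicit schedule plus ONE certified height `T` gives `FIN(a)` on every
window scheduled below `T`. -/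
theorem fin_of_wht_of_le {T₁ : ℝ → ℝ} (h : (∀ a : ℝ, RiemannHypothesisUpTo (T₁ a) → WeilPositivityOn a)) {T : ℝ} (hT : RiemannHypothesisUpTo T) {a : ℝ}
    (ha : T₁ a ≤ T) : WeilPositivityOn a :=
  h a (riemannHypothesisUpTo_anti ha hT)

end Summit.RiemannHypothesis.RiemannHypothesis.Theorems.Splittings.WeilHeightTransferDetectors

end
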